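import Literature.AlgebraicGeometry.Resolution.AffineBlowupAlgebra
import HarnessLib

/-!
# Standard charts of the blow-up of affine space along a coordinate subspace are affine spaces

Topic: `Literature/AlgebraicGeometry/Resolution`. Let `S` be a commutative ring, `σ` a set of
variables, `A ⊆ σ` and `i₀ ∈ A`. The blow-up of `𝔸^σ_S = Spec S[X_σ]` along the
coordinate subspace `Z = V(X_i : i ∈ A)` has, over the generator `X_{i₀}`, the standard affine
chart `Spec S[X_σ][I/X_{i₀}]` (`I = (X_i : i ∈ A)`; the affine blowup algebra
`R[I/a] ⊆ R[1/a]` of `AffineBlowupAlgebra.lean`, which IS the chart ring `(R[It])_{(at)}` of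
`Proj R[It]` by `reesChartEquiv`). This file PROVES the statement "applied throughout" Hu's
*Universal characteristic-free resolution I* (arXiv:2507.21400, §5, Definition 5.2 and
Proposition 5.3 — "the following proposition is standard"): **this chart is again the
affine space `𝔸^σ_S`, with free variables `ζ := y'₀` (the exceptional parameter),
`y_i := ξ_i` (proper transforms of the other centre variables) and the untouched `y'`, and the
blow-up map is the substitution `y'_i = ζ · y_i` (`i ∈ A ∖ {i₀}`), `y'₀ = ζ`** — i.e.
Görtz–Wedhorn (13.19) for a linear centre, in coordinates.

## Content (all PROVED; definitions with full API, no named facts — D-0026)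

* `coordBlowupSubst S A i₀ : S[X_σ] →ₐ[S] S[X_σ]` — Hu's substitution
  `X_i ↦ X_{i₀} X_i` for `i ∈ A ∖ {i₀}`, `X_i ↦ X_i` otherwise (Prop. 5.3:
  `y'_i = ζ y_i`, `y'₀ = ζ`);
  `coordBlowupSubst_X_of_mem_of_ne`, `coordBlowupSubst_X_self`,
  `coordBlowupSubst_X_of_not_mem`, `map_coordBlowupSubst_span_eq` (**`E ∩ 𝔙 = (ζ = 0)`**:
  the centre ideal becomes `(X_{i₀})`).
* `coordBlowupChartMap S A i₀ : S[X_σ] →ₐ[S] S[X_σ][1/X_{i₀}]` — `X_i ↦ X_i/X_{i₀}`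
  (`i ∈ A ∖ {i₀}`), `X_i ↦ X_i` otherwise; `coordBlowupChartMap_coordBlowupSubst`
  (**chart ∘ substitution = localisation map**), `coordBlowupChartMap_injective` (via the
  retraction of `S[X_σ][1/X_{i₀}]` extending the substitution, and `X_{i₀}` being a
  non-zero-divisor), `range_coordBlowupChartMap` (**the image is exactly the affine blowup
  algebra `S[X_σ][I/X_{i₀}]`**).
* `coordBlowupChartEquiv S A i₀ : S[X_σ] ≃ₐ[S] S[X_σ][I/X_{i₀}]` and
  `coordBlowupChartEquiv_coordBlowupSubst` / `coordBlowupChartEquiv_symm_algebraMap`: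
  **under this isomorphism the structure map `S[X_σ] → S[X_σ][I/X_{i₀}]` of the blow-up chart
  is `coordBlowupSubst`** (Hu Prop. 5.3; Stacks 0804 for `D₊(a^{(1)}) = Spec R[I/a]`);
  `coordBlowupReesChartEquiv` — the same for the chart ring `(R[It])_{(X_{i₀} t)}` of
  `Proj R[It] = affineBlowup I` (`reesChartEquiv`), with
  `coordBlowupReesChartEquiv_reesChartBase`.

No hypothesis `i₀ ∈ A` is needed for the ring-theoretic statements (for `i₀ ∉ A` the algebra
`R[I/X_{i₀}]` is still the displayed subalgebra); it enters in `map_coordBlowupSubst_span_eq`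
and in `coordBlowupReesChartEquiv` (where the chart of `Proj` requires `X_{i₀} ∈ I`).

## References

* Y. Hu, *Universal Characteristic-free Resolution of Singularities, I*, arXiv:2507.21400 (2025),
  §5, Def. 5.1–5.2, Prop. 5.3 (theorem numbers of the arXiv v1 TeX source). [Hu2025]
* The Stacks Project, Tags 052P, 052Q, 0804 (affine blowup algebras and the charts of a
  blowing up). [StacksProject]
* U. Görtz, T. Wedhorn, *Algebraic Geometry I*, 2nd ed. (2020), (13.19) p. 415. [GortzWedhorn2020]
-/

noncomputable section

open MvPolynomial IsLocalization

namespace Literature.AlgebraicGeometry.Resolution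

universe u v

variable (S : Type u) [CommRing S] {σ : Type v} (A : Set σ) (i₀ : σ)

/-! ### The substitution `X_i ↦ X_{i₀} X_i` (`i ∈ A ∖ {i₀}`) -/

open Classical in
/-- **Hu's blow-up substitution** on the polynomial ring `S[X_σ]`: `X_i ↦ X_{i₀} · X_i` for
`i ∈ A ∖ {i₀}` and `X_i ↦ X_i` otherwise (Hu 2025, Prop. 5.3: on the standard chart
`(ξ₀ ≡ 1)` of the blow-up along `{y'₀ = ⋯ = y'_m = 0}` one has `y'_i = ζ y_i` with
`ζ := y'₀`, `y_i := ξ_i`).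
[cite: Hu2025, §5 Prop. 5.3] -/
def coordBlowupSubst : MvPolynomial σ S →ₐ[S] MvPolynomial σ S :=
  aeval fun i => if i ∈ A ∧ i ≠ i₀ then X i₀ * X i else X i

open Classical in
/-- The substitution on a variable. [cite: Hu2025, §5 Prop. 5.3] -/
theorem coordBlowupSubst_X (i : σ) :
    coordBlowupSubst S A i₀ (X i) = if i ∈ A ∧ i ≠ i₀ then X i₀ * X i else X i := by
  simp [coordBlowupSubst]

/-- `X_i ↦ X_{i₀} X_i` on the centre variables other than `X_{i₀}`.
[cite: Hu2025, §5 Prop. 5.3] -/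
@[simp] theorem coordBlowupSubst_X_of_mem_of_ne {i : σ} (hi : i ∈ A) (hne : i ≠ i₀) :
    coordBlowupSubst S A i₀ (X i) = X i₀ * X i := by
  rw [coordBlowupSubst_X, if_pos ⟨hi, hne⟩]

/-- `X_{i₀} ↦ X_{i₀}` (the exceptional parameter `ζ = y'₀`).
[cite: Hu2025, §5 Prop. 5.3] -/
@[simp] theorem coordBlowupSubst_X_self : coordBlowupSubst S A i₀ (X i₀) = X i₀ := by
  rw [coordBlowupSubst_X, if_neg (fun h => h.2 rfl)]

/-- `X_i ↦ X_i` off the centre variables. [cite: Hu2025, §5 Prop. 5.3] -/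
@[simp] theorem coordBlowupSubst_X_of_not_mem {i : σ} (hi : i ∉ A) :
    coordBlowupSubst S A i₀ (X i) = X i := by
  rw [coordBlowupSubst_X, if_neg (fun h => hi h.1)]

/-- The substitution is `S`-linear: constants are fixed. [folklore] -/
@[simp] theorem coordBlowupSubst_C (c : S) : coordBlowupSubst S A i₀ (C c) = C c :=
  (coordBlowupSubst S A i₀).commutes c

/-- **`E ∩ 𝔙 = (ζ = 0)`**: the substitution carries the ideal of the centre `(X_i : i ∈ A)`
onto the principal ideal `(X_{i₀})` (Hu 2025, Prop. 5.3, first bullet; Stacks 07Z3 (2):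
`I · R[I/a] = a · R[I/a]`). [cite: Hu2025, §5 Prop. 5.3] -/
theorem map_coordBlowupSubst_span_eq (hi₀ : i₀ ∈ A) :
    (Ideal.span (X '' A)).map (coordBlowupSubst S A i₀) =
      Ideal.span {(X i₀ : MvPolynomial σ S)} := by
  apply le_antisymm
  · rw [Ideal.map_span, Ideal.span_le]
    rintro _ ⟨_, ⟨i, hi, rfl⟩, rfl⟩
    by_cases hne : i = i₀
    · subst hne
      rw [coordBlowupSubst_X_self]
      exact Ideal.subset_span rfl
    · change coordBlowupSubst S A i₀ (X i) ∈ Ideal.span {X i₀}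
      rw [coordBlowupSubst_X_of_mem_of_ne S A i₀ hi hne]
      exact Ideal.mul_mem_right _ _ (Ideal.subset_span rfl)
  · rw [Ideal.span_le, Set.singleton_subset_iff]
    have h := Ideal.mem_map_of_mem (coordBlowupSubst S A i₀)
      (Ideal.subset_span (s := X '' A) ⟨i₀, hi₀, rfl⟩)
    rwa [coordBlowupSubst_X_self] at h

/-! ### The chart map `X_i ↦ X_i / X_{i₀}` -/

open Classical in
/-- **The chart map** `S[X_σ] → S[X_σ][1/X_{i₀}]`: `X_i ↦ X_i / X_{i₀}` for
`i ∈ A ∖ {i₀}`, `X_i ↦ X_i` otherwise (the free variables `y_i = ξ_i = y'_i/y'₀` of the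
standard chart,
Hu 2025, Def. 5.2–Prop. 5.3; GW (13.19): `A[I/f] ⊆ A_f` generated by the `x/f`).
[cite: Hu2025, §5 Prop. 5.3] [cite: GortzWedhorn2020, (13.19) p. 415] -/
def coordBlowupChartMap :
    MvPolynomial σ S →ₐ[S] Localization.Away (X i₀ : MvPolynomial σ S) :=
  aeval fun i => if i ∈ A ∧ i ≠ i₀ then
    algebraMap (MvPolynomial σ S) (Localization.Away (X i₀ : MvPolynomial σ S)) (X i) *
      Away.invSelf (X i₀ : MvPolynomial σ S)
    else algebraMap (MvPolynomial σ S) (Localization.Away (X i₀ : MvPolynomial σ S)) (X i)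

open Classical in
/-- The chart map on a variable. [cite: Hu2025, §5 Prop. 5.3] -/
theorem coordBlowupChartMap_X (i : σ) :
    coordBlowupChartMap S A i₀ (X i) = if i ∈ A ∧ i ≠ i₀ then
      algebraMap (MvPolynomial σ S) (Localization.Away (X i₀ : MvPolynomial σ S)) (X i) *
        Away.invSelf (X i₀ : MvPolynomial σ S)
      else
        algebraMap (MvPolynomial σ S) (Localization.Away (X i₀ : MvPolynomial σ S)) (X i) := by
  simp [coordBlowupChartMap]

/-- `X_i ↦ X_i / X_{i₀}` on the centre variables other than `X_{i₀}` (the free variables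
`y_i = ξ_i`). [cite: Hu2025, §5 Prop. 5.3] -/
@[simp] theorem coordBlowupChartMap_X_of_mem_of_ne {i : σ} (hi : i ∈ A) (hne : i ≠ i₀) :
    coordBlowupChartMap S A i₀ (X i) =
      algebraMap (MvPolynomial σ S) (Localization.Away (X i₀ : MvPolynomial σ S)) (X i) *
        Away.invSelf (X i₀ : MvPolynomial σ S) := by
  rw [coordBlowupChartMap_X, if_pos ⟨hi, hne⟩]

/-- `X_{i₀} ↦ X_{i₀}` (the exceptional parameter `ζ`). [cite: Hu2025, §5 Prop. 5.3] -/
@[simp] theorem coordBlowupChartMap_X_self :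
    coordBlowupChartMap S A i₀ (X i₀) =
      algebraMap (MvPolynomial σ S) (Localization.Away (X i₀ : MvPolynomial σ S)) (X i₀) := by
  rw [coordBlowupChartMap_X, if_neg (fun h => h.2 rfl)]

/-- `X_i ↦ X_i` off the centre variables. [cite: Hu2025, §5 Prop. 5.3] -/
@[simp] theorem coordBlowupChartMap_X_of_not_mem {i : σ} (hi : i ∉ A) :
    coordBlowupChartMap S A i₀ (X i) =
      algebraMap (MvPolynomial σ S) (Localization.Away (X i₀ : MvPolynomial σ S)) (X i) := by
  rw [coordBlowupChartMap_X, if_neg (fun h => hi h.1)]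

/-- The chart map on constants. [folklore] -/
@[simp] theorem coordBlowupChartMap_C (c : S) :
    coordBlowupChartMap S A i₀ (C c) =
      algebraMap (MvPolynomial σ S) (Localization.Away (X i₀ : MvPolynomial σ S)) (C c) := by
  rw [← MvPolynomial.algebraMap_eq, AlgHom.commutes]
  rfl

/-- **Chart map ∘ substitution = the localisation map `S[X_σ] → S[X_σ][1/X_{i₀}]`**: the
substitution is the structure map of the chart (`(X_i/X_{i₀}) · X_{i₀} = X_i`).
[cite: Hu2025, §5 Prop. 5.3] -/
theorem coordBlowupChartMap_comp_coordBlowupSubst :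
    (coordBlowupChartMap S A i₀).comp (coordBlowupSubst S A i₀) =
      IsScalarTower.toAlgHom S (MvPolynomial σ S)
        (Localization.Away (X i₀ : MvPolynomial σ S)) := by
  refine MvPolynomial.algHom_ext fun i => ?_
  rw [AlgHom.comp_apply, IsScalarTower.toAlgHom_apply]
  by_cases hi : i ∈ A
  · by_cases hne : i = i₀
    · subst hne
      rw [coordBlowupSubst_X_self, coordBlowupChartMap_X_self]
    · rw [coordBlowupSubst_X_of_mem_of_ne S A i₀ hi hne, map_mul, coordBlowupChartMap_X_self,
        coordBlowupChartMap_X_of_mem_of_ne S A i₀ hi hne, mul_comm, mul_assoc,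
        mul_comm (Away.invSelf (X i₀ : MvPolynomial σ S)), Away.mul_invSelf, mul_one]
  · rw [coordBlowupSubst_X_of_not_mem S A i₀ hi, coordBlowupChartMap_X_of_not_mem S A i₀ hi]

/-- Pointwise form of `coordBlowupChartMap_comp_coordBlowupSubst`: `chart (subst p) = p/1`.
[cite: Hu2025, §5 Prop. 5.3] -/
theorem coordBlowupChartMap_coordBlowupSubst (p : MvPolynomial σ S) :
    coordBlowupChartMap S A i₀ (coordBlowupSubst S A i₀ p) =
      algebraMap (MvPolynomial σ S) (Localization.Away (X i₀ : MvPolynomial σ S)) p := by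
  have h := congrArg (fun φ => φ p) (coordBlowupChartMap_comp_coordBlowupSubst S A i₀)
  simpa using h

/-- `X_{i₀}` is a non-zero-divisor of `S[X_σ]`, so `S[X_σ] → S[X_σ][1/X_{i₀}]` is
injective. [folklore] -/
theorem algebraMap_away_X_injective :
    Function.Injective
      (algebraMap (MvPolynomial σ S) (Localization.Away (X i₀ : MvPolynomial σ S))) :=
  IsLocalization.injective (Localization.Away (X i₀ : MvPolynomial σ S))
    (M := Submonoid.powers (X i₀ : MvPolynomial σ S))
    (Submonoid.powers_le.2 (MvPolynomial.isRegular_X).mem_nonZeroDivisors)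

/-- **The chart map is injective.** The substitution extends to a ring endomorphism `θ` of
`S[X_σ][1/X_{i₀}]` (it fixes `X_{i₀}`, a unit there), and `θ ∘ coordBlowupChartMap` is the
injective localisation map. [folklore] -/
theorem coordBlowupChartMap_injective : Function.Injective (coordBlowupChartMap S A i₀) := by
  let g : MvPolynomial σ S →+* (Localization.Away (X i₀ : MvPolynomial σ S)) :=
    (algebraMap (MvPolynomial σ S) (Localization.Away (X i₀ : MvPolynomial σ S))).comp
      (coordBlowupSubst S A i₀).toRingHom
  have hg : IsUnit (g (X i₀)) := by
    simp only [g, RingHom.coe_comp, Function.comp_apply, AlgHom.toRingHom_eq_coe,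
      RingHom.coe_coe, coordBlowupSubst_X_self]
    exact IsLocalization.Away.algebraMap_isUnit (X i₀)
  let θ : (Localization.Away (X i₀ : MvPolynomial σ S)) →+*
      (Localization.Away (X i₀ : MvPolynomial σ S)) := IsLocalization.Away.lift (X i₀) hg
  have hθalg : ∀ q : MvPolynomial σ S,
      θ (algebraMap (MvPolynomial σ S) (Localization.Away (X i₀ : MvPolynomial σ S)) q) =
        algebraMap (MvPolynomial σ S) (Localization.Away (X i₀ : MvPolynomial σ S))
          (coordBlowupSubst S A i₀ q) :=
    fun q => IsLocalization.Away.lift_eq (X i₀) hg q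
  have hθinv : θ (Away.invSelf (X i₀ : MvPolynomial σ S)) *
      algebraMap (MvPolynomial σ S)
        (Localization.Away (X i₀ : MvPolynomial σ S)) (X i₀) = 1 := by
    have h1 : θ (algebraMap (MvPolynomial σ S)
        (Localization.Away (X i₀ : MvPolynomial σ S)) (X i₀) *
        Away.invSelf (X i₀ : MvPolynomial σ S)) = 1 := by
      rw [Away.mul_invSelf, map_one]
    rw [map_mul, hθalg, coordBlowupSubst_X_self] at h1
    rwa [mul_comm] at h1
  have hθ : θ.comp (coordBlowupChartMap S A i₀).toRingHom =
      algebraMap (MvPolynomial σ S) (Localization.Away (X i₀ : MvPolynomial σ S)) := by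
    refine MvPolynomial.ringHom_ext (fun c => ?_) (fun i => ?_)
    · simp only [RingHom.coe_comp, Function.comp_apply, AlgHom.toRingHom_eq_coe, RingHom.coe_coe,
        coordBlowupChartMap_C, hθalg, coordBlowupSubst_C]
    · simp only [RingHom.coe_comp, Function.comp_apply, AlgHom.toRingHom_eq_coe, RingHom.coe_coe]
      by_cases hi : i ∈ A
      · by_cases hne : i = i₀
        · subst hne
          rw [coordBlowupChartMap_X_self, hθalg, coordBlowupSubst_X_self]
        · rw [coordBlowupChartMap_X_of_mem_of_ne S A i₀ hi hne, map_mul, hθalg,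
            coordBlowupSubst_X_of_mem_of_ne S A i₀ hi hne, map_mul,
            mul_comm (algebraMap (MvPolynomial σ S)
              (Localization.Away (X i₀ : MvPolynomial σ S)) (X i₀)),
            mul_assoc,
            mul_comm (algebraMap (MvPolynomial σ S)
              (Localization.Away (X i₀ : MvPolynomial σ S)) (X i₀)),
            hθinv, mul_one]
      · rw [coordBlowupChartMap_X_of_not_mem S A i₀ hi, hθalg,
          coordBlowupSubst_X_of_not_mem S A i₀ hi]
  intro p q hpq
  apply algebraMap_away_X_injective S i₀
  have h := congrArg θ hpq
  have hp := congrArg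
    (fun φ : MvPolynomial σ S →+* (Localization.Away (X i₀ : MvPolynomial σ S)) => φ p) hθ
  have hq := congrArg
    (fun φ : MvPolynomial σ S →+* (Localization.Away (X i₀ : MvPolynomial σ S)) => φ q) hθ
  simp only [RingHom.coe_comp, Function.comp_apply, AlgHom.toRingHom_eq_coe,
    RingHom.coe_coe] at hp hq
  rw [← hp, ← hq]
  exact h

/-- Every value of the chart map lies in the affine blowup algebra `S[X_σ][I/X_{i₀}]`,
`I = (X_i : i ∈ A)`. [cite: GortzWedhorn2020, (13.19) p. 415] -/
theorem coordBlowupChartMap_mem (p : MvPolynomial σ S) :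
    coordBlowupChartMap S A i₀ p ∈
      blowupAlgebra (Ideal.span (X '' A)) (X i₀ : MvPolynomial σ S) := by
  induction p using MvPolynomial.induction_on with
  | C c =>
    rw [coordBlowupChartMap_C]
    exact Subalgebra.algebraMap_mem _ _
  | add p q hp hq =>
    rw [map_add]
    exact Subalgebra.add_mem _ hp hq
  | mul_X p i hp =>
    rw [map_mul]
    refine Subalgebra.mul_mem _ hp ?_
    by_cases hi : i ∈ A
    · by_cases hne : i = i₀
      · subst hne
        rw [coordBlowupChartMap_X_self]
        exact Subalgebra.algebraMap_mem _ _
      · rw [coordBlowupChartMap_X_of_mem_of_ne S A i₀ hi hne]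
        exact div_mem_blowupAlgebra _ _ (Ideal.subset_span ⟨i, hi, rfl⟩)
    · rw [coordBlowupChartMap_X_of_not_mem S A i₀ hi]
      exact Subalgebra.algebraMap_mem _ _

/-- **The image of the chart map is exactly the affine blowup algebra `S[X_σ][I/X_{i₀}]`.**
[cite: GortzWedhorn2020, (13.19) p. 415] [cite: StacksProject, Tag 052Q] -/
theorem range_coordBlowupChartMap :
    Set.range (coordBlowupChartMap S A i₀) =
      (blowupAlgebra (Ideal.span (X '' A)) (X i₀ : MvPolynomial σ S) :
        Set (Localization.Away (X i₀ : MvPolynomial σ S))) := by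
  apply le_antisymm
  · rintro _ ⟨p, rfl⟩
    exact coordBlowupChartMap_mem S A i₀ p
  · -- the range is an `S[X_σ]`-subalgebra containing the generators `x / X_{i₀}`, `x ∈ I`
    let B : Subalgebra (MvPolynomial σ S) (Localization.Away (X i₀ : MvPolynomial σ S)) :=
      { carrier := Set.range (coordBlowupChartMap S A i₀)
        mul_mem' := by
          rintro _ _ ⟨p, rfl⟩ ⟨q, rfl⟩
          exact ⟨p * q, map_mul _ _ _⟩
        one_mem' := ⟨1, map_one _⟩
        add_mem' := by
          rintro _ _ ⟨p, rfl⟩ ⟨q, rfl⟩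
          exact ⟨p + q, map_add _ _ _⟩
        zero_mem' := ⟨0, map_zero _⟩
        algebraMap_mem' := fun r =>
          ⟨coordBlowupSubst S A i₀ r, coordBlowupChartMap_coordBlowupSubst S A i₀ r⟩ }
    change (blowupAlgebra (Ideal.span (X '' A)) (X i₀ : MvPolynomial σ S) :
      Set (Localization.Away (X i₀ : MvPolynomial σ S))) ⊆
        (B : Set (Localization.Away (X i₀ : MvPolynomial σ S)))
    have hle : blowupAlgebra (Ideal.span (X '' A)) (X i₀ : MvPolynomial σ S) ≤ B := by
      refine Algebra.adjoin_le ?_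
      rintro _ ⟨x, hx, rfl⟩
      -- `x ∈ (X_i : i ∈ A)`: induct over the span
      refine Submodule.span_induction (p := fun x _ =>
        algebraMap (MvPolynomial σ S) (Localization.Away (X i₀ : MvPolynomial σ S)) x *
          Away.invSelf (X i₀ : MvPolynomial σ S) ∈ B) ?_ ?_ ?_ ?_ hx
      · rintro _ ⟨i, hi, rfl⟩
        by_cases hne : i = i₀
        · subst hne
          rw [Away.mul_invSelf]
          exact B.one_mem
        · exact ⟨X i, coordBlowupChartMap_X_of_mem_of_ne S A i₀ hi hne⟩
      · rw [map_zero, zero_mul]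
        exact B.zero_mem
      · intro x y _ _ hx hy
        rw [map_add, add_mul]
        exact B.add_mem hx hy
      · intro r x _ hx
        rw [smul_eq_mul, map_mul, mul_assoc]
        exact B.mul_mem (B.algebraMap_mem r) hx
    exact hle

/-! ### The chart isomorphism `S[X_σ] ≅ S[X_σ][I/X_{i₀}]` -/

/-- The chart map with values in the affine blowup algebra, as an `S`-algebra homomorphism.
[cite: GortzWedhorn2020, (13.19) p. 415] -/
def coordBlowupChartHom :
    MvPolynomial σ S →ₐ[S]
      blowupAlgebra (Ideal.span (X '' A)) (X i₀ : MvPolynomial σ S) where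
  toFun p := ⟨coordBlowupChartMap S A i₀ p, coordBlowupChartMap_mem S A i₀ p⟩
  map_one' := Subtype.ext (map_one _)
  map_mul' p q := Subtype.ext (map_mul _ _ _)
  map_zero' := Subtype.ext (map_zero _)
  map_add' p q := Subtype.ext (map_add _ _ _)
  commutes' c := Subtype.ext (by
    change coordBlowupChartMap S A i₀ (algebraMap S (MvPolynomial σ S) c) =
      algebraMap S (Localization.Away (X i₀ : MvPolynomial σ S)) c
    rw [AlgHom.commutes])

/-- The underlying element of `coordBlowupChartHom p` is `coordBlowupChartMap p`. [folklore] -/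
@[simp] theorem coe_coordBlowupChartHom_apply (p : MvPolynomial σ S) :
    (coordBlowupChartHom S A i₀ p : (Localization.Away (X i₀ : MvPolynomial σ S))) =
      coordBlowupChartMap S A i₀ p :=
  rfl

/-- `coordBlowupChartHom` is bijective (injective chart map with image the affine blowup
algebra). [cite: StacksProject, Tag 052Q] -/
theorem coordBlowupChartHom_bijective : Function.Bijective (coordBlowupChartHom S A i₀) := by
  refine ⟨fun p q h => coordBlowupChartMap_injective S A i₀ (congrArg Subtype.val h),
    fun z => ?_⟩
  have hz : (z : (Localization.Away (X i₀ : MvPolynomial σ S))) ∈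
      Set.range (coordBlowupChartMap S A i₀) := by
    rw [range_coordBlowupChartMap]
    exact z.2
  obtain ⟨p, hp⟩ := hz
  exact ⟨p, Subtype.ext hp⟩

/-- **The standard chart of the blow-up of `𝔸^σ_S` along `V(X_i : i ∈ A)` over `X_{i₀}` is
the affine space `𝔸^σ_S`**: `S[X_σ] ≅ S[X_σ][I/X_{i₀}]`, `X_i ↦ X_i/X_{i₀}`
(`i ∈ A ∖ {i₀}`),
`X_i ↦ X_i` otherwise (Hu 2025, Prop. 5.3: the standard chart "comes equipped with a set of free
variables `{ζ, y₁, …, y_m; y}`"). [cite: Hu2025, §5 Prop. 5.3]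
[cite: StacksProject, Tag 052Q] -/
def coordBlowupChartEquiv :
    MvPolynomial σ S ≃ₐ[S] blowupAlgebra (Ideal.span (X '' A)) (X i₀ : MvPolynomial σ S) :=
  AlgEquiv.ofBijective (coordBlowupChartHom S A i₀) (coordBlowupChartHom_bijective S A i₀)

/-- The underlying element of `coordBlowupChartEquiv p` is `coordBlowupChartMap p`. [folklore] -/
@[simp] theorem coe_coordBlowupChartEquiv_apply (p : MvPolynomial σ S) :
    (coordBlowupChartEquiv S A i₀ p : (Localization.Away (X i₀ : MvPolynomial σ S))) =
      coordBlowupChartMap S A i₀ p :=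
  rfl

/-- **Under the chart isomorphism the structure map of the blow-up chart is Hu's substitution**:
`coordBlowupChartEquiv (coordBlowupSubst p) = p` read in `S[X_σ][I/X_{i₀}]`, i.e. the composite
`S[X_σ] → S[X_σ][I/X_{i₀}] ≅ S[X_σ]` is `X_i ↦ X_{i₀} X_i` (`i ∈ A ∖ {i₀}`),
`X_i ↦ X_i` otherwise.
[cite: Hu2025, §5 Prop. 5.3] -/
theorem coordBlowupChartEquiv_coordBlowupSubst (p : MvPolynomial σ S) :
    coordBlowupChartEquiv S A i₀ (coordBlowupSubst S A i₀ p) =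
      algebraMap (MvPolynomial σ S)
        (blowupAlgebra (Ideal.span (X '' A)) (X i₀ : MvPolynomial σ S)) p :=
  Subtype.ext (coordBlowupChartMap_coordBlowupSubst S A i₀ p)

/-- Equivalently: the inverse chart isomorphism sends `r ∈ S[X_σ] ⊆ S[X_σ][I/X_{i₀}]` to
`coordBlowupSubst r`. [cite: Hu2025, §5 Prop. 5.3] -/
theorem coordBlowupChartEquiv_symm_algebraMap (p : MvPolynomial σ S) :
    (coordBlowupChartEquiv S A i₀).symm
      (algebraMap (MvPolynomial σ S)
        (blowupAlgebra (Ideal.span (X '' A)) (X i₀ : MvPolynomial σ S)) p) =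
      coordBlowupSubst S A i₀ p := by
  rw [← coordBlowupChartEquiv_coordBlowupSubst, AlgEquiv.symm_apply_apply]

/-- As ring maps: `coordBlowupChartEquiv⁻¹ ∘ algebraMap = coordBlowupSubst`.
[cite: Hu2025, §5 Prop. 5.3] -/
theorem coordBlowupChartEquiv_symm_comp_algebraMap :
    ((coordBlowupChartEquiv S A i₀).symm : _ →+* MvPolynomial σ S).comp
      (algebraMap (MvPolynomial σ S)
        (blowupAlgebra (Ideal.span (X '' A)) (X i₀ : MvPolynomial σ S))) =
      (coordBlowupSubst S A i₀ : MvPolynomial σ S →+* MvPolynomial σ S) :=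
  RingHom.ext fun p => coordBlowupChartEquiv_symm_algebraMap S A i₀ p

/-! ### The chart ring of `Proj R[It] = affineBlowup I` -/

/-- `X_{i₀} ∈ (X_i : i ∈ A)` for `i₀ ∈ A`. [folklore] -/
theorem X_mem_span_image (hi₀ : i₀ ∈ A) :
    (X i₀ : MvPolynomial σ S) ∈ Ideal.span (X '' A) :=
  Ideal.subset_span ⟨i₀, hi₀, rfl⟩

/-- **The chart ring `(R[It])_{(X_{i₀} t)}` of the blowing up `Proj R[It]` of `R = S[X_σ]` in
`I = (X_i : i ∈ A)` is the polynomial ring `S[X_σ]`** (`reesChartEquiv` followed by the inverse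
of `coordBlowupChartEquiv`; Stacks 0804: `D₊(a^{(1)}) = Spec R[I/a]`).
[cite: StacksProject, Tag 0804] [cite: Hu2025, §5 Prop. 5.3] -/
def coordBlowupReesChartEquiv (hi₀ : i₀ ∈ A) :
    HomogeneousLocalization.Away (reesGrading (Ideal.span (X '' A)))
        (reesT (X i₀ : MvPolynomial σ S) (X_mem_span_image S A i₀ hi₀)) ≃+*
      MvPolynomial σ S :=
  (reesChartEquiv (X i₀ : MvPolynomial σ S) (X_mem_span_image S A i₀ hi₀)).trans
    (coordBlowupChartEquiv S A i₀).symm.toRingEquiv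

/-- Under `coordBlowupReesChartEquiv` the structure map
`reesChartBase : S[X_σ] → (R[It])_{(X_{i₀} t)}` of the chart becomes Hu's substitution
`coordBlowupSubst`. [cite: Hu2025, §5 Prop. 5.3] -/
theorem coordBlowupReesChartEquiv_reesChartBase (hi₀ : i₀ ∈ A) (r : MvPolynomial σ S) :
    coordBlowupReesChartEquiv S A i₀ hi₀
      (reesChartBase (X i₀ : MvPolynomial σ S) (X_mem_span_image S A i₀ hi₀) r) =
      coordBlowupSubst S A i₀ r := by
  rw [coordBlowupReesChartEquiv, RingEquiv.trans_apply, reesChartEquiv_reesChartBase]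
  exact coordBlowupChartEquiv_symm_algebraMap S A i₀ r

end Literature.AlgebraicGeometry.Resolution

end
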